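import Summits.BirchSwinnertonDyer.BirchSwinnertonDyer.Theorems.KatoDescentPotSupersingularWildUpperMuRoadThreeFukudaRecords29
import Summits.BirchSwinnertonDyer.BirchSwinnertonDyer.Theorems.KatoDescentTamePotSupersingularCartanMuRoadQuadraticUpperDoors
import HarnessLib

/-!
# Route `KatoDescentPotSupersingular` (rung K9, sub-rung B5 O6 wild `p = 3`, cell `bsd-potss`) — COURTESY by seat `bsd-potss-k8t-c4` g23 for the k9-c4 lane:
# the `3Ns` `K⁺`-road rows of `KatoDescentPotSupersingularWildUpperMuRoadThreeFukudaRecordsNoF29` (k9-c4 g25 NoF re-issue of `KatoDescentPotSupersingularWildUpperMuRoadThreeFukudaRecords29`) RE-RECORDED with Ferrero–Washington REMOVED —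
# U₀ `MissingUpperBoundAt E 3` modulo `hKatoA hGZK hmod` ONLY (`--supports stmt-BirchSwinnertonDyer-19197 --as helper`; closes nothing)

HONEST FRAMING. Route-free THEOREMS ONLY (no definition, no named fact, no `sorry`); PER ROW — NOT a class theorem; nothing is booked; items 19189 / 19197
stay OPEN at class level (class-wide open inputs unchanged: the zeta crux 24327 and the residual 19200); (A), Conjecture A and BSD are proved for NO curve as a class.
WHAT CHANGED (g23): the NoF records displayed ONE named fact beyond `hKatoA hGZK hmod` — Ferrero–Washington (`hFW`), consumed by the `D₄` Kuroda road on the biquadratic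
subfield `ℚ(√−3, √d)` of `ℚ(E[3])` and on a quadratic field inside `K⁺ = ℚ(E[3])^c`. By the character count of `Literature/…/IwasawaTheory/ClassicalMuVanishesCartanQuadraticDescent`
+ `…CartanImageThreeQuadratic` (k8t-c4 g23: on `Gal(ℚ(E[3])/ℚ) ⊆ N_s(3) = D₄` every irreducible character occurs in `Ind_⟨c⟩ 1 = K⁺` except the linear ones with `χ(c) = −1`,
whose fields are the IMAGINARY QUADRATIC subfields) `hFW` is replaced by the displayed datum `hqrk`: «for every quadratic `K ⊆ ℚ(E[3])` NOT fixed by the complex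
conjugation `c` and every cyclotomic `ℤ₃`-extension of `K`, `rank₃ Cl(K₁) = rank₃ Cl(K₀)`» — Fukuda 1994 Thm. 1 (2), a tree theorem (index `0` on every subfield of `ℚ(E[3])`,
Serre Prop. 15). NUMERICS (kit j327492: the factorisation `ψ₃ = q₁·q₂` over `ℚ` gives the quadratic subfields `ℚ(√disc q₁)`, `ℚ(√disc q₂)`, `ℚ(√−3)` of `ℚ(E[3])`; kit j327492 / j327503: `bnfinit` + `bnfcertify` at
degrees 2, 6 and — for the fields in which `3` SPLITS (`ℚ(√−8)`, `ℚ(√−11)`, `ℚ(√−71)`: `λ ≥ 1`, ranks `0 → 1` at layers `(0,1)`) — degree 18 (layers `(1,2)`)): per row below, the quadratic subfields of `ℚ(E[3])` and, for each imaginary one, `h`, `Cl(K₁)`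
(`K₁ = K·ℚ(ζ₉)⁺`, `K₂ = K·ℚ(ζ₂₇)⁺`) and the `3`-ranks at layers `(m, m+1)`, `m ∈ {0, 1}` by row. The `K⁺` datum (`hord` / `hrk`), Cremona's `r_an = 0` and the kernel certificates (`irr_…`, `classO6_…`,
`hasSplitCartanNormalizerModPImage_…`) are those of the source records, REUSED. Door: `CartanMuRoadQuadraticDoors.missingUpperBoundAt_three_wild_of_hasSplitCartanNormalizerModPImage_of_real{,Rank}SuccEqAt_of_quadRankSuccEqAt` (k8t-c4 g23).
[cite: Fukuda1994, Thm. 1, p. 264] [cite: CoatesSujatha2005, Thm. 3.4 (§3)] [cite: Kato2004Asterisque, Thm. 14.5 (3) (p. 236), Thm. 12.5 (3) (p. 222)] [cite: Serre1972, §2.2, §2.4 Prop. 15, §5.2 (iv)]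
[cite: Washington1997, §13.1, §13.3 Prop. 13.23] [cite: Cremona2006, Table 1]
-/

set_option autoImplicit false
set_option linter.dupNamespace false

noncomputable section

open scoped Classical NumberField
open Polynomial WeierstrassCurve Field IntermediateField IsDedekindDomain
  Literature.NumberTheory.EllipticCurves Literature.NumberTheory.EllipticCurves.Rank1Residual
  Literature.NumberTheory.EllipticCurves.Rank1Residual.Typed
  Literature.NumberTheory.GaloisRepresentations Literature.NumberTheory.SerreUniformity Literature.NumberTheory.IwasawaTheory
  Summit.BirchSwinnertonDyer.Rank1Residual Summit.BirchSwinnertonDyer.Rank1Residual.Additive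
  Summit.BirchSwinnertonDyer.BirchSwinnertonDyer.Theorems
  Summit.BirchSwinnertonDyer.BirchSwinnertonDyer.Theorems.TameUpperUnitTwistRecords

namespace Summit.BirchSwinnertonDyer.BirchSwinnertonDyer.Theorems.WildUpperUnitTwistRecords

/-- **RECORD — UPPER half `ord₃ #Ш(E) ≤ ord₃ #Ш(E)_an` for `E = 292032ej1` at `p = 3` (O6 wild, `3Ns`) from `rank₃ Cl(K⁺_{2}) = rank₃ Cl(K⁺_{1})` on `K⁺ = ℚ(E[3])^c` and the imaginary-quadratic rank datum `hqrk`,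
modulo `hKatoA hGZK hmod` ONLY** (Ferrero–Washington REMOVED; Coates–Sujatha 3.4 / Fukuda Thm. 1 tree theorems; kernel certificates `classO6_…`, `irr_…`, `hasSplitCartanNormalizerModPImage_…`
reused; the `K⁺` numerics are those quoted in the source record). DISPLAYED: quadratic subfields of `ℚ(E[3])` (degree 8; kit j327492, `ψ₃ = q₁·q₂`): `ℚ(√-39)`, `ℚ(√-3)`, `ℚ(√13)`; the imaginary ones certified for `hqrk` at layers (0,1) (kit j327492): `ℚ(√-3)`: `h = 1` (`Cl ≅ []`), `K₁ = ℚ(√-3)·ℚ(ζ₉)⁺` = `x^6 - x^3 + 1`, `h(K₁) = 1` (`Cl ≅ []`), `rank₃` at layers (0,1): `0 = 0` — bnfcertify 1/1; `ℚ(√-39)`: `h = 4` (`Cl ≅ [4]`), `K₁ = ℚ(√-39)·ℚ(ζ₉)⁺` = `x^6 + 18*x^4 - 10*x^3 + 81*x^2 - 90*x + 181`, `h(K₁) = 4` (`Cl ≅ [4]`), `rank₃` at layers (0,1): `0 = 0` — bnfcertify 1/1. Per row; nothing booked; BSD is not proved by this.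
[cite: Kato2004Asterisque, Thm. 14.5 (3) (p. 236)] [cite: Fukuda1994, Thm. 1, p. 264] [cite: CoatesSujatha2005, Thm. 3.4 (§3)] [cite: Cremona2006, Table 1 (Cremona label 292032ej1)] -/
theorem missingUpperBoundAt_g292032ej1_3_fkK12rQuad
    (hKatoA : Kato2004.rankZero_padicValNat_sha_add_padicValNat_tamagawa_le_of_additive_potGood_of_irreducible_of_fineSelmerDual_fg)
    (hGZK : rank_eq_analyticRank_of_analyticRank_le_one) (hmod : hasEntireLFunction_rat)
    {W : WeierstrassCurve ℚ} [W.IsElliptic] [W.IsGloballyMinimal] (hWeq : W = (⟨0, 0, 0, (-131820), 41584816⟩ : WeierstrassCurve ℚ)) (hr : W.analyticRank = 0)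
    {c : absoluteGaloisGroup ℚ} (hc : IsComplexConjugation (Rat.castHom ℝ) c)
    (hrk : haveI : NumberField ↥(W.divisionField 3) := NumberField.mk
      ∀ κE : ZpExtension ↥(fixedField (Subgroup.zpowers (absRestrictNormalHom (W.divisionField 3) c))) 3,
        κE.IsCyclotomic → classGroupPRank κE (1 + 1) = classGroupPRank κE 1)
    (hqrk : haveI : NumberField ↥(W.divisionField 3) := NumberField.mk
      ∀ K : IntermediateField ℚ ↥(W.divisionField 3), Module.finrank ℚ ↥K = 2 →
        ¬ K ≤ fixedField (Subgroup.zpowers (absRestrictNormalHom (W.divisionField 3) c)) →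
        ∀ κE : ZpExtension ↥K 3, κE.IsCyclotomic → classGroupPRank κE (0 + 1) = classGroupPRank κE 0) :
    MissingUpperBoundAt W 3 := by
  subst hWeq
  haveI : Fact (Nat.Prime 3) := ⟨Nat.prime_three⟩
  exact CartanMuRoadQuadraticDoors.missingUpperBoundAt_three_wild_of_hasSplitCartanNormalizerModPImage_of_realRankSuccEqAt_of_quadRankSuccEqAt _
    hKatoA hGZK hmod hr classO6_g292032ej1_3 irr_g292032ej1_3 hasSplitCartanNormalizerModPImage_g292032ej1_3 hc 1 hrk 0 hqrk

/-- **RECORD — UPPER half `ord₃ #Ш(E) ≤ ord₃ #Ш(E)_an` for `E = 292032en1` at `p = 3` (O6 wild, `3Ns`) from `rank₃ Cl(K⁺_{2}) = rank₃ Cl(K⁺_{1})` on `K⁺ = ℚ(E[3])^c` and the imaginary-quadratic rank datum `hqrk`,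
modulo `hKatoA hGZK hmod` ONLY** (Ferrero–Washington REMOVED; Coates–Sujatha 3.4 / Fukuda Thm. 1 tree theorems; kernel certificates `classO6_…`, `irr_…`, `hasSplitCartanNormalizerModPImage_…`
reused; the `K⁺` numerics are those quoted in the source record). DISPLAYED: quadratic subfields of `ℚ(E[3])` (degree 8; kit j327492, `ψ₃ = q₁·q₂`): `ℚ(√-39)`, `ℚ(√-3)`, `ℚ(√13)`; the imaginary ones certified for `hqrk` at layers (0,1) (kit j327492): `ℚ(√-3)`: `h = 1` (`Cl ≅ []`), `K₁ = ℚ(√-3)·ℚ(ζ₉)⁺` = `x^6 - x^3 + 1`, `h(K₁) = 1` (`Cl ≅ []`), `rank₃` at layers (0,1): `0 = 0` — bnfcertify 1/1; `ℚ(√-39)`: `h = 4` (`Cl ≅ [4]`), `K₁ = ℚ(√-39)·ℚ(ζ₉)⁺` = `x^6 + 18*x^4 - 10*x^3 + 81*x^2 - 90*x + 181`, `h(K₁) = 4` (`Cl ≅ [4]`), `rank₃` at layers (0,1): `0 = 0` — bnfcertify 1/1. Per row; nothing booked; BSD is not proved by this.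
[cite: Kato2004Asterisque, Thm. 14.5 (3) (p. 236)] [cite: Fukuda1994, Thm. 1, p. 264] [cite: CoatesSujatha2005, Thm. 3.4 (§3)] [cite: Cremona2006, Table 1 (Cremona label 292032en1)] -/
theorem missingUpperBoundAt_g292032en1_3_fkK12rQuad
    (hKatoA : Kato2004.rankZero_padicValNat_sha_add_padicValNat_tamagawa_le_of_additive_potGood_of_irreducible_of_fineSelmerDual_fg)
    (hGZK : rank_eq_analyticRank_of_analyticRank_le_one) (hmod : hasEntireLFunction_rat)
    {W : WeierstrassCurve ℚ} [W.IsElliptic] [W.IsGloballyMinimal] (hWeq : W = (⟨0, 0, 0, (-780), 18928⟩ : WeierstrassCurve ℚ)) (hr : W.analyticRank = 0)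
    {c : absoluteGaloisGroup ℚ} (hc : IsComplexConjugation (Rat.castHom ℝ) c)
    (hrk : haveI : NumberField ↥(W.divisionField 3) := NumberField.mk
      ∀ κE : ZpExtension ↥(fixedField (Subgroup.zpowers (absRestrictNormalHom (W.divisionField 3) c))) 3,
        κE.IsCyclotomic → classGroupPRank κE (1 + 1) = classGroupPRank κE 1)
    (hqrk : haveI : NumberField ↥(W.divisionField 3) := NumberField.mk
      ∀ K : IntermediateField ℚ ↥(W.divisionField 3), Module.finrank ℚ ↥K = 2 →
        ¬ K ≤ fixedField (Subgroup.zpowers (absRestrictNormalHom (W.divisionField 3) c)) →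
        ∀ κE : ZpExtension ↥K 3, κE.IsCyclotomic → classGroupPRank κE (0 + 1) = classGroupPRank κE 0) :
    MissingUpperBoundAt W 3 := by
  subst hWeq
  haveI : Fact (Nat.Prime 3) := ⟨Nat.prime_three⟩
  exact CartanMuRoadQuadraticDoors.missingUpperBoundAt_three_wild_of_hasSplitCartanNormalizerModPImage_of_realRankSuccEqAt_of_quadRankSuccEqAt _
    hKatoA hGZK hmod hr classO6_g292032en1_3 irr_g292032en1_3 hasSplitCartanNormalizerModPImage_g292032en1_3 hc 1 hrk 0 hqrk

end Summit.BirchSwinnertonDyer.BirchSwinnertonDyer.Theorems.WildUpperUnitTwistRecords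

end
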